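import Summits.Ventures.QEC.Census.CertControls
import Summits.Ventures.QEC.Census.CertPopcount
import Summits.Ventures.QEC.Census.BZAutPermFast
import Mathlib.Data.Nat.Bitwise
import HarnessLib

/-!
# Kernel-fast commutation check for large sparse certificates (`commOKFast`) — a bridge to `commOK` / `checkStructure`
# (qec-type-12 g4; unblocks the structural part of one-sided KERNEL rows at `n ≳ 200`, INBOX 04:35Z measurement)

`commOK n HX HZ` (type-10, `Census/CertCheck.lean`) evaluates `popc n (hx &&& hz) % 2` for every pair of rows, and
`popc n` walks all `n` bit positions: `|HX|·|HZ|·n` kernel steps — measured > 1200 s (farm timeout) on a `[[270,16,6]]`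
two-block certificate (135 × 135 rows).  Check rows of LDPC certificates are SPARSE (weight 6–9), so the meet
`hx &&& hz` has a handful of bits: `popcLow fuel x` counts them by clearing the lowest set bit (`x &&& (x − 1)`) and
STOPS when `x = 0` — cost = weight, not `n`.  `popcLow_eq_popc`: with fuel `n` it IS `popc n x` for `x < 2^n`
(type-10's `popc_and_pred` / `popc_pos`).  Hence

* `commOKFast n HX HZ` (rows `< 2^n` + pairwise parity by `popcLow`) and `commOK_of_commOKFast`;
* better still for many rows: `commOKCols n HX HZ` / `commOKColsData HX cols` — the `Z`-syndrome of each `X`-row as the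
  XOR of the COLUMN words of `HZ` it selects (`xorSel (colWords n HZ) hx = labelWord n HZ hx`, `BZAutPermFast`):
  `|HX|·n + n·|HZ|` kernel steps; bridges `commOK_of_commOKCols`, `commOK_of_commOKColsData (hcols : colWords n HZ = cols)`;
* `synZeroCols` / `upperOKCols` (syndromes of the upper witnesses through column words) with bridges;
* `DistCert.checkStructureFast` (commutation by `popcLow`) / `DistCert.checkStructureCols colsX colsZ` (commutation AND
  all syndromes through column words supplied as data) and `DistCert.checkStructure_of_fast` /
  `DistCert.checkStructure_of_cols`, so
  `commOK_of_checkStructure`, `isCode_of_onesided_lower`, … apply verbatim to a `decide +kernel` verdict of the fast form.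

Tier KERNEL, axioms standard, no `native_decide`; no certificate is read here.
-/

namespace Summit.Ventures.QEC.Census

/-! ## Sparse popcount -/

/-- Popcount by clearing the lowest set bit, at most `fuel` times, stopping at `0`: `popcLow (fuel+1) x =
if x = 0 then 0 else 1 + popcLow fuel (x &&& (x − 1))`. Kernel cost = number of set bits. (definition) -/
def popcLow : ℕ → ℕ → ℕ
  | 0, _ => 0
  | fuel + 1, x => if x = 0 then 0 else popcLow fuel (x &&& (x - 1)) + 1

/-- With enough fuel the sparse count is the popcount: `popc n x ≤ fuel → x < 2^n → popcLow fuel x = popc n x`. -/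
theorem popcLow_eq_popc_of_le (n : ℕ) : ∀ (fuel x : ℕ), popc n x ≤ fuel → x < 2 ^ n → popcLow fuel x = popc n x
  | 0, x, hf, hx => by
    rw [popcLow]
    omega
  | fuel + 1, x, hf, hx => by
    rw [popcLow]
    by_cases h0 : x = 0
    · subst h0; simp [popc_zero]
    · rw [if_neg h0]
      have hpred := popc_and_pred n h0 hx
      have hlt : x &&& (x - 1) < 2 ^ n := lt_of_le_of_lt Nat.and_le_left hx
      rw [popcLow_eq_popc_of_le n fuel (x &&& (x - 1)) (by omega) hlt]
      omega

/-- **`popcLow n x = popc n x`** for `x < 2^n`. -/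
theorem popcLow_eq_popc {n x : ℕ} (hx : x < 2 ^ n) : popcLow n x = popc n x :=
  popcLow_eq_popc_of_le n n x (popc_le n x) hx

/-! ## The fast commutation check and its bridges -/

/-- **Fast commutation check**: all rows are words `< 2^n` and every `X`-row meets every `Z`-row evenly, the parity
computed by the sparse popcount. (definition, `decide +kernel`) -/
def commOKFast (n : ℕ) (HX HZ : List ℕ) : Bool :=
  (HX.all fun hx => decide (hx < 2 ^ n)) &&
    HX.all fun hx => HZ.all fun hz => popcLow n (hx &&& hz) % 2 == 0

/-- **Bridge**: the fast commutation check implies type-10's `commOK`. -/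
theorem commOK_of_commOKFast {n : ℕ} {HX HZ : List ℕ} (h : commOKFast n HX HZ = true) : commOK n HX HZ = true := by
  simp only [commOKFast, Bool.and_eq_true, List.all_eq_true, decide_eq_true_eq, beq_iff_eq] at h
  obtain ⟨hlt, hpar⟩ := h
  simp only [commOK, synZero, List.all_eq_true, beq_iff_eq]
  intro hx hhx hz hhz
  have hxlt : hx &&& hz < 2 ^ n := lt_of_le_of_lt Nat.and_le_left (hlt hx hhx)
  have := hpar hx hhx hz hhz
  rw [popcLow_eq_popc hxlt] at this
  rwa [Nat.land_comm hz hx]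

/-! ## Commutation through COLUMN words: `|HX|·n + n·|HZ|` steps instead of `|HX|·|HZ|` popcounts -/

/-- **Commutation by column words**: the `Z`-syndrome of every `X`-row, computed as the XOR of the column words of
`HZ` selected by the row (`xorSel (colWords n HZ) hx`, = `labelWord n HZ hx` by `xorSel_colWords`), vanishes.
(definition, `decide +kernel`) -/
def commOKCols (n : ℕ) (HX HZ : List ℕ) : Bool :=
  let cols := colWords n HZ
  HX.all fun hx => xorSel cols hx == 0

/-- The same on column words supplied as DATA (`cols`, to be identified with `colWords n HZ` by one `decide`).
(definition, `decide +kernel`) -/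
def commOKColsData (HX cols : List ℕ) : Bool := HX.all fun hx => xorSel cols hx == 0

/-- A vanishing label word means every row parity vanishes. -/
theorem synZero_of_labelWord_eq_zero {n : ℕ} {H : List ℕ} {v : ℕ} (h : labelWord n H v = 0) : synZero n H v = true := by
  simp only [synZero, List.all_eq_true, beq_iff_eq]
  intro r hr
  obtain ⟨i, hi, rfl⟩ := List.getElem_of_mem hr
  have hb := testBit_labelWord n H v i
  rw [h, Nat.zero_testBit] at hb
  have hget : H.getD i 0 = H[i] := by
    rw [List.getD_eq_getElem?_getD, List.getElem?_eq_getElem hi, Option.getD_some]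
  rw [hget] at hb
  have := Nat.mod_two_eq_zero_or_one (popc n (H[i] &&& v))
  rcases this with h0 | h1
  · exact h0
  · rw [h1] at hb; simp at hb

/-- **Bridge** (data form): with `colWords n HZ = cols`, the column check implies `commOK`. -/
theorem commOK_of_commOKColsData {n : ℕ} {HX HZ cols : List ℕ} (hcols : colWords n HZ = cols)
    (h : commOKColsData HX cols = true) : commOK n HX HZ = true := by
  subst hcols
  simp only [commOKColsData, List.all_eq_true, beq_iff_eq] at h
  simp only [commOK, List.all_eq_true]
  intro hx hhx
  have h0 := h hx hhx
  rw [xorSel_colWords] at h0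
  exact synZero_of_labelWord_eq_zero h0

/-- **Bridge**: the column check implies type-10's `commOK`. -/
theorem commOK_of_commOKCols {n : ℕ} {HX HZ : List ℕ} (h : commOKCols n HX HZ = true) : commOK n HX HZ = true :=
  commOK_of_commOKColsData rfl h

namespace DistCert

/-- `checkStructure` with the commutation conjunct in the fast form. (definition, `decide +kernel`) -/
def checkStructureFast (c : DistCert) : Bool :=
  commOKFast c.n c.HX c.HZ && upperOK c.n c.HX c.HZ c.sideZ.d c.sideZ.witness c.sideZ.nonmember &&
    foundOK c.HZ c.sideZ.found && upperOK c.n c.HZ c.HX c.sideX.d c.sideX.witness c.sideX.nonmember &&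
    foundOK c.HX c.sideX.found

/-- **Bridge**: `c.checkStructureFast = true → c.checkStructure = true` (so `commOK_of_checkStructure`,
`isCode_of_onesided_lower`, the brute-force / BZ / one-sided assemblies apply verbatim). -/
theorem checkStructure_of_fast {c : DistCert} (h : c.checkStructureFast = true) : c.checkStructure = true := by
  simp only [checkStructureFast, Bool.and_eq_true] at h
  obtain ⟨⟨⟨⟨h1, h2⟩, h3⟩, h4⟩, h5⟩ := h
  simp only [checkStructure, Bool.and_eq_true]
  exact ⟨⟨⟨⟨commOK_of_commOKFast h1, h2⟩, h3⟩, h4⟩, h5⟩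

end DistCert

/-! ## Syndromes through column words: `synZero` / `upperOK` without popcounts -/

/-- `synZero` through column words: the syndrome word `xorSel cols v` (`cols = colWords n H`) vanishes. (definition) -/
def synZeroCols (cols : List ℕ) (v : ℕ) : Bool := xorSel cols v == 0

/-- **Bridge**: `colWords n H = cols → synZeroCols cols v = true → synZero n H v = true`. -/
theorem synZero_of_synZeroCols {n : ℕ} {H cols : List ℕ} {v : ℕ} (hcols : colWords n H = cols)
    (h : synZeroCols cols v = true) : synZero n H v = true := by
  subst hcols
  simp only [synZeroCols, beq_iff_eq] at h
  rw [xorSel_colWords] at h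
  exact synZero_of_labelWord_eq_zero h

/-- `upperOK` with both syndrome checks through column words (`colsSyn = colWords n Hsyn`, `colsStab = colWords n Hstab`);
the two single popcounts stay. (definition, `decide +kernel`) -/
def upperOKCols (n : ℕ) (colsSyn colsStab : List ℕ) (d v u : ℕ) : Bool :=
  synZeroCols colsSyn v && (popc n v == d) && synZeroCols colsStab u && (popc n (u &&& v) % 2 == 1)

/-- **Bridge** for `upperOK`. -/
theorem upperOK_of_cols {n : ℕ} {Hsyn Hstab colsSyn colsStab : List ℕ} {d v u : ℕ}
    (hs : colWords n Hsyn = colsSyn) (ht : colWords n Hstab = colsStab)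
    (h : upperOKCols n colsSyn colsStab d v u = true) : upperOK n Hsyn Hstab d v u = true := by
  simp only [upperOKCols, Bool.and_eq_true] at h
  obtain ⟨⟨⟨h1, h2⟩, h3⟩, h4⟩ := h
  simp only [upperOK, Bool.and_eq_true]
  exact ⟨⟨⟨synZero_of_synZeroCols hs h1, h2⟩, synZero_of_synZeroCols ht h3⟩, h4⟩

namespace DistCert

/-- **`checkStructure` through column words**: commutation and all four syndrome checks read the column words
`colsX = colWords n HX`, `colsZ = colWords n HZ` (supplied as DATA, each identified by one `decide`); allow-lists as
before. Kernel cost `O((|HX| + |HZ| + 4) · n)` word steps instead of `O(|HX|·|HZ|·n)`. (definition, `decide +kernel`) -/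
def checkStructureCols (c : DistCert) (colsX colsZ : List ℕ) : Bool :=
  commOKColsData c.HX colsZ && upperOKCols c.n colsX colsZ c.sideZ.d c.sideZ.witness c.sideZ.nonmember &&
    foundOK c.HZ c.sideZ.found && upperOKCols c.n colsZ colsX c.sideX.d c.sideX.witness c.sideX.nonmember &&
    foundOK c.HX c.sideX.found

/-- **Bridge**: `colWords c.n c.HX = colsX → colWords c.n c.HZ = colsZ → c.checkStructureCols colsX colsZ = true →
c.checkStructure = true` — so `commOK_of_checkStructure`, `isCode_of_onesided(_lower)`, the brute-force / BZ / one-sided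
assemblies apply verbatim. -/
theorem checkStructure_of_cols {c : DistCert} {colsX colsZ : List ℕ} (hX : colWords c.n c.HX = colsX)
    (hZ : colWords c.n c.HZ = colsZ) (h : c.checkStructureCols colsX colsZ = true) : c.checkStructure = true := by
  simp only [checkStructureCols, Bool.and_eq_true] at h
  obtain ⟨⟨⟨⟨h1, h2⟩, h3⟩, h4⟩, h5⟩ := h
  simp only [checkStructure, Bool.and_eq_true]
  exact ⟨⟨⟨⟨commOK_of_commOKColsData hZ h1, upperOK_of_cols hX hZ h2⟩, h3⟩, upperOK_of_cols hZ hX h4⟩, h5⟩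

end DistCert

/-! ## Controls (kernel `decide`) -/

/-- `popcLow` on small words, and agreement with `popc`. -/
example : popcLow 8 0 = 0 ∧ popcLow 8 0b10110 = 3 ∧ popcLow 8 255 = 8 ∧ popc 8 0b10110 = 3 := by decide

/-- Steane and `[[4,2,2]]` pass the fast structural check (as they pass `checkStructure`). -/
example : certSteane7.checkStructureFast = true ∧ certC422.checkStructureFast = true := by decide

/-- A non-commuting pair is rejected: rows `011₂` / `001₂` meet oddly — by both fast forms. -/
example : commOKFast 3 [3] [1] = false ∧ commOKFast 3 [3] [3] = true ∧
    commOKCols 3 [3] [1] = false ∧ commOKCols 3 [3] [3] = true := by decide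

/-- Steane and `[[4,2,2]]` pass the column-word structural check with their column words as data. -/
example : certSteane7.checkStructureCols (colWords 7 certSteane7.HX) (colWords 7 certSteane7.HZ) = true ∧
    certC422.checkStructureCols (colWords 4 certC422.HX) (colWords 4 certC422.HZ) = true := by decide

end Summit.Ventures.QEC.Census
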